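import Mathlib
import HarnessLib
import Summits.AtomisticToContinuum.HydrodynamicLimit.Theses.PesinPricing

/-!
# Crux `GronwallU` (stmt-AtomisticToContinuum-14536) — birth skeleton (BC3), line `birth`

Route `route-AtomisticToContinuum-PesinPricing`; crux (fixed, route decl):
`GronwallU : PricedBoltzmannProperty → EnergyCurrentTails → RelEntropyVanishing`.

The canonical first cut of the (noiseless) Olla–Varadhan–Yau / Yau relative-entropy architecture
(OllaVaradhanYau1993 §§2–4, Yau1991, KipnisLandim1999 Ch. 6) into REFERENCE STATICS and the
ENTROPY GRONWALL:

* `stub_initialReference` (statics at time 0, M/L): the initial local Gibbs laws are probability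
  measures for `σ < σ₀` (packing), and if the law of large numbers holds at time `0` then the Euler
  initial velocity / temperature ARE the profiles (`u 0 = u₀`, `θ 0 = θ₀`; uniqueness of limits in
  probability + continuity + `ρ 0 > 0`) and the initial law `localGibbsLaw σ a₀ (u 0) (θ 0)` is a
  GOOD REFERENCE at time `0`: its empirical density / momentum / energy fields concentrate
  exponentially around `(ρ, ρu, E)(0)` (inhomogeneous low-density cluster expansion, Ruelle1969 Ch. 4,
  LebowitzPenrose1964; the 0767-type statics).
* `stub_referenceFamily` (statics along the solution, L): for every `s ∈ (0, T)` there is an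
  activity profile `b = a_s` (inverting the hard-sphere equation of state at `(ρ_s, θ_s)`; total mass
  `∫ ρ_s = 1` from the LLN at time 0 and conservation) whose local Gibbs law `(a_s, u_s, θ_s)` is a
  good reference at time `s` (probability measure + exponential concentration around `(ρ,ρu,E)(s)`).
  This stub carries the packing exposure of the unguarded target `RelEntropyVanishing` (σ₀ is fixed
  before the Euler solution; inversion needs `ρ_s σ³` in the fluid regime).
* `stub_entropyGronwall` (the dynamic content, XL): GIVEN the priced Boltzmann property and the
  energy-current tails, and GIVEN any reference family `a` pinned at `a 0 = a₀` (so `H_N(0) = 0`)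
  that is good at every `s ∈ [0, T)`, Yau's relative entropy `H(f_t | ψ_t)/(N+1) → 0` for every
  `t < T` — velocity truncation by `EnergyCurrentTails`, dense-patch cutoff by the entropy inequality,
  one-block through the OVY limit states (dilute part Gibbs by `PricedBoltzmannProperty` (iv)),
  virial identification, LD upper bound for the reference, Gronwall. No noise, no two-block.

`GronwallU_of_stubs` is the pure-logic composition `stub₁-sig → stub₂-sig → stub₃-sig →
(PricedBoltzmannProperty → EnergyCurrentTails → RelEntropyVanishing)` (min of the three `σ₀`, the
family glued from the time-0 reference and the positive-time references by choice; no sorry), and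
`GronwallU_of : GronwallU := GronwallU_of_stubs stub_… stub_… stub_…` is the registered skeleton
theorem concluding the crux BY NAME with no hypotheses (A12 shape: sorries only inside the stubs).
-/

namespace Summit.AtomisticToContinuum.HydrodynamicLimit.Cruxes.GronwallU.Birth

/-- stub 1 — INITIAL DATA IDENTIFICATION AND INITIAL REFERENCE (time-0 statics): for continuous
positive profiles there is `σ₀ > 0` such that for `0 < σ < σ₀`, every classical hard-sphere Euler
solution on `[0,T)` and every flow family: the initial local Gibbs laws are probability measures, and
if `0 < T` and the LLN holds at time `0` then `u 0 = u₀`, `θ 0 = θ₀` and the initial law written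
through the Euler data, `localGibbsLaw σ a₀ (u 0) (θ 0)`, is a probability measure whose empirical
fields concentrate exponentially around `(ρ, ρu, E)(0)`. Cluster expansion at low density
(Ruelle1969 Ch. 4, LebowitzPenrose1964) + uniqueness of limits in probability. -/
theorem stub_initialReference : ∀ (a₀ θ₀ : Literature.MathematicalPhysics.KineticTheory.T3 → ℝ) (u₀ : Literature.MathematicalPhysics.KineticTheory.T3 → Literature.MathematicalPhysics.KineticTheory.V3), Continuous a₀ → Continuous θ₀ → Continuous u₀ → (∀ x, 0 < a₀ x) → (∀ x, 0 < θ₀ x) → ∃ σ₀ : ℝ, 0 < σ₀ ∧ ∀ σ : ℝ, 0 < σ → σ < σ₀ → ∀ (T : ℝ) (ρ θ : ℝ → Literature.MathematicalPhysics.KineticTheory.T3 → ℝ) (u : ℝ → Literature.MathematicalPhysics.KineticTheory.T3 → Literature.MathematicalPhysics.KineticTheory.V3), Literature.MathematicalPhysics.KineticTheory.IsHardSphereEulerSolution σ T ρ u θ → ∀ Φ : (N : ℕ) → Literature.Analysis.FluidPDE.HardSphereFlow (Literature.Analysis.FluidPDE.Torus.geometry (Fin 3)) (Literature.MathematicalPhysics.KineticTheory.hsDiameter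 σ N) (N + 1), (∀ N, MeasureTheory.IsProbabilityMeasure (Literature.MathematicalPhysics.KineticTheory.localGibbsLaw σ a₀ u₀ θ₀ N (Φ N))) ∧ (0 < T → Literature.MathematicalPhysics.KineticTheory.TendstoHydroFieldsAt (fun N => Literature.MathematicalPhysics.KineticTheory.localGibbsLaw σ a₀ u₀ θ₀ N (Φ N)) Φ ρ u θ 0 → u 0 = u₀ ∧ θ 0 = θ₀ ∧ ((∀ N, MeasureTheory.IsProbabilityMeasure (Literature.MathematicalPhysics.KineticTheory.localGibbsLaw σ a₀ (u 0) (θ 0) N (Φ N))) ∧ (∀ χ : Literature.MathematicalPhysics.KineticTheory.T3 → ℝ, Continuous χ → ∀ δ : ℝ, 0 < δ → ∃ C : ℝ, 0 < C ∧ ∀ N : ℕ, Literature.MathematicalPhysics.KineticTheory.localGibbsLaw σ a₀ (u 0) (θ 0) N (Φ N) {z | δ < |Literature.MathematicalPhysics.KineticTheory.empiricalDensityField z χ - ∫ x, χ x * ρ 0 x|} ≤ ENNReal.ofReal (C * Real.exp (-(C⁻¹ * (N + 1)))) ∧ Literature.MathematicalPhysics.KineticTheory.localGibbsLaw σ a₀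 (u 0) (θ 0) N (Φ N) {z | δ < ‖Literature.MathematicalPhysics.KineticTheory.empiricalMomentumField z χ - ∫ x, (χ x * ρ 0 x) • u 0 x‖} ≤ ENNReal.ofReal (C * Real.exp (-(C⁻¹ * (N + 1)))) ∧ Literature.MathematicalPhysics.KineticTheory.localGibbsLaw σ a₀ (u 0) (θ 0) N (Φ N) {z | δ < |Literature.MathematicalPhysics.KineticTheory.empiricalEnergyField z χ - ∫ x, χ x * Literature.MathematicalPhysics.KineticTheory.totalEnergyDensity (ρ 0 x) (u 0 x) (θ 0 x)|} ≤ ENNReal.ofReal (C * Real.exp (-(C⁻¹ * (N + 1))))))) := by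
  sorry

/-- stub 2 — GOOD REFERENCE FAMILY AT POSITIVE TIMES (statics along the Euler solution; equation of
state inversion): for `0 < σ < σ₀` and every classical solution whose fields match the initial local
Gibbs law at time `0` (so `∫ ρ_s = 1`), at every `s ∈ (0,T)` there is an activity profile `b` whose
local Gibbs law `(b, u_s, θ_s)` is a probability measure with exponential concentration of the
empirical fields around `(ρ, ρu, E)(s)`. Ruelle1969 §3.4, §4; LebowitzPenrose1964; Spohn1991 Part I
Ch. 3. Carries the packing exposure of the unguarded target (ρ_s σ³ must stay in the fluid regime). -/
theorem stub_referenceFamily : ∀ (a₀ θ₀ : Literature.MathematicalPhysics.KineticTheory.T3 → ℝ) (u₀ : Literature.MathematicalPhysics.KineticTheory.T3 → Literature.MathematicalPhysics.KineticTheory.V3), Continuous a₀ → Continuous θ₀ → Continuous u₀ → (∀ x, 0 < a₀ x) → (∀ x, 0 < θ₀ x) → ∃ σ₀ : ℝ, 0 < σ₀ ∧ ∀ σ : ℝ, 0 < σ → σ < σ₀ → ∀ (T : ℝ) (ρ θ : ℝ → Literature.MathematicalPhysics.KineticTheory.T3 → ℝ) (u : ℝ → Literature.MathematicalPhysics.KineticTheory.T3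 → Literature.MathematicalPhysics.KineticTheory.V3), Literature.MathematicalPhysics.KineticTheory.IsHardSphereEulerSolution σ T ρ u θ → ∀ Φ : (N : ℕ) → Literature.Analysis.FluidPDE.HardSphereFlow (Literature.Analysis.FluidPDE.Torus.geometry (Fin 3)) (Literature.MathematicalPhysics.KineticTheory.hsDiameter σ N) (N + 1), (Literature.MathematicalPhysics.KineticTheory.TendstoHydroFieldsAt (fun N => Literature.MathematicalPhysics.KineticTheory.localGibbsLaw σ a₀ u₀ θ₀ N (Φ N)) Φ ρ u θ 0 → ∀ s ∈ Set.Ioo 0 T, ∃ b : Literature.MathematicalPhysics.KineticTheory.T3 → ℝ, ((∀ N, MeasureTheory.IsProbabilityMeasure (Literature.MathematicalPhysics.KineticTheory.localGibbsLaw σ b (u s) (θ s) N (Φ N))) ∧ (∀ χ : Literature.MathematicalPhysics.KineticTheory.T3 → ℝ, Continuous χ → ∀ δ : ℝ, 0 < δ → ∃ C : ℝ, 0 < C ∧ ∀ N : ℕ, Literature.MathematicalPhysics.KineticTheory.localGibbsLaw σ b (u s) (θ s) N (Φ N) {z | δ < |Literature.MathematicalPhysics.KineticTheory.empiricalDensityField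 z χ - ∫ x, χ x * ρ s x|} ≤ ENNReal.ofReal (C * Real.exp (-(C⁻¹ * (N + 1)))) ∧ Literature.MathematicalPhysics.KineticTheory.localGibbsLaw σ b (u s) (θ s) N (Φ N) {z | δ < ‖Literature.MathematicalPhysics.KineticTheory.empiricalMomentumField z χ - ∫ x, (χ x * ρ s x) • u s x‖} ≤ ENNReal.ofReal (C * Real.exp (-(C⁻¹ * (N + 1)))) ∧ Literature.MathematicalPhysics.KineticTheory.localGibbsLaw σ b (u s) (θ s) N (Φ N) {z | δ < |Literature.MathematicalPhysics.KineticTheory.empiricalEnergyField z χ - ∫ x, χ x * Literature.MathematicalPhysics.KineticTheory.totalEnergyDensity (ρ s x) (u s x) (θ s x)|} ≤ ENNReal.ofReal (C * Real.exp (-(C⁻¹ * (N + 1))))))) := by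
  sorry

/-- stub 3 — YAU'S RELATIVE-ENTROPY GRONWALL FOR THE DETERMINISTIC DILUTE HARD-SPHERE GAS (the
dynamic content of the crux): given `PricedBoltzmannProperty` and `EnergyCurrentTails`, for
`0 < σ < σ₀`, every classical solution, every flow family and every reference activity family `a`
with `a 0 = a₀`, `u 0 = u₀`, `θ 0 = θ₀` (so the reference at time 0 IS the initial law and
`H_N(0) = 0`) that is a good reference at every `s ∈ [0,T)`, the relative entropy of the evolved law
with respect to the local Gibbs law `(a_t, u_t, θ_t)` is `o(N)` at every `t ∈ [0,T)`.
OllaVaradhanYau1993 §§2–4 (with noise), Yau1991, KipnisLandim1999 Ch. 6; noiseless here. -/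
theorem stub_entropyGronwall : Summit.AtomisticToContinuum.HydrodynamicLimit.Theses.PesinPricing.PricedBoltzmannProperty → Summit.AtomisticToContinuum.HydrodynamicLimit.Theses.PesinPricing.EnergyCurrentTails → ∀ (a₀ θ₀ : Literature.MathematicalPhysics.KineticTheory.T3 → ℝ) (u₀ : Literature.MathematicalPhysics.KineticTheory.T3 → Literature.MathematicalPhysics.KineticTheory.V3), Continuous a₀ → Continuous θ₀ → Continuous u₀ → (∀ x, 0 < a₀ x) → (∀ x, 0 < θ₀ x) → ∃ σ₀ : ℝ, 0 < σ₀ ∧ ∀ σ : ℝ, 0 < σ → σ < σ₀ → ∀ (T : ℝ) (ρ θ : ℝ → Literature.MathematicalPhysics.KineticTheory.T3 → ℝ) (u : ℝ → Literature.MathematicalPhysics.KineticTheory.T3 → Literature.MathematicalPhysics.KineticTheory.V3), Literature.MathematicalPhysics.KineticTheory.IsHardSphereEulerSolution σ T ρ u θ → ∀ Φ : (N : ℕ) → Literature.Analysis.FluidPDE.HardSphereFlow (Literature.Analysis.FluidPDE.Torus.geometry (Fin 3)) (Literature.MathematicalPhysics.KineticTheory.hsDiameter σ N) (N + 1), ∀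 a : ℝ → Literature.MathematicalPhysics.KineticTheory.T3 → ℝ, a 0 = a₀ → u 0 = u₀ → θ 0 = θ₀ → Literature.MathematicalPhysics.KineticTheory.TendstoHydroFieldsAt (fun N => Literature.MathematicalPhysics.KineticTheory.localGibbsLaw σ a₀ u₀ θ₀ N (Φ N)) Φ ρ u θ 0 → (∀ s ∈ Set.Ico 0 T, ((∀ N, MeasureTheory.IsProbabilityMeasure (Literature.MathematicalPhysics.KineticTheory.localGibbsLaw σ (a s) (u s) (θ s) N (Φ N))) ∧ (∀ χ : Literature.MathematicalPhysics.KineticTheory.T3 → ℝ, Continuous χ → ∀ δ : ℝ, 0 < δ → ∃ C : ℝ, 0 < C ∧ ∀ N : ℕ, Literature.MathematicalPhysics.KineticTheory.localGibbsLaw σ (a s) (u s) (θ s) N (Φ N) {z | δ < |Literature.MathematicalPhysics.KineticTheory.empiricalDensityField z χ - ∫ x, χ x * ρ s x|} ≤ ENNReal.ofReal (C * Real.exp (-(C⁻¹ * (N + 1)))) ∧ Literature.MathematicalPhysics.KineticTheory.localGibbsLaw σ (a s) (u s) (θ s) N (Φ N) {z | δ < ‖Literature.MathematicalPhysics.KineticTheory.empiricalMomentumField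 z χ - ∫ x, (χ x * ρ s x) • u s x‖} ≤ ENNReal.ofReal (C * Real.exp (-(C⁻¹ * (N + 1)))) ∧ Literature.MathematicalPhysics.KineticTheory.localGibbsLaw σ (a s) (u s) (θ s) N (Φ N) {z | δ < |Literature.MathematicalPhysics.KineticTheory.empiricalEnergyField z χ - ∫ x, χ x * Literature.MathematicalPhysics.KineticTheory.totalEnergyDensity (ρ s x) (u s x) (θ s x)|} ≤ ENNReal.ofReal (C * Real.exp (-(C⁻¹ * (N + 1))))))) → ∀ t ∈ Set.Ico 0 T, Filter.Tendsto (fun N : ℕ => InformationTheory.klDiv ((Φ N).lawAt (Literature.MathematicalPhysics.KineticTheory.localGibbsLaw σ a₀ u₀ θ₀ N (Φ N)) t) (Literature.MathematicalPhysics.KineticTheory.localGibbsLaw σ (a t) (u t) (θ t) N (Φ N)) / ((N : ENNReal) + 1)) Filter.atTop (nhds 0) := by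
  sorry

/-- ASSEMBLY (pure logic, no sorry) — the three stub statements imply the body of the crux,
`PricedBoltzmannProperty → EnergyCurrentTails → RelEntropyVanishing` (to which `GronwallU` unfolds
definitionally): take the minimum of the three `σ₀`; the first conjunct of `RelEntropyVanishing` is
stub 1's; given the LLN at time 0 and `t ∈ [0,T)` (so `0 < T`), stub 1 identifies `u 0 = u₀`,
`θ 0 = θ₀` and gives the time-0 reference `a₀`, stub 2 gives references at positive times, choice
glues them into a family `a` with `a 0 = a₀` good on `[0,T)`, and stub 3 gives the entropy limit at
`t` for the witness `a t`. (Stated with the unfolded conclusion so that `GronwallU_of` below is the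
unique theorem of this file concluding the crux constant by name, as the A12 skeleton audit wants.) -/
theorem GronwallU_of_stubs : (∀ (a₀ θ₀ : Literature.MathematicalPhysics.KineticTheory.T3 → ℝ) (u₀ : Literature.MathematicalPhysics.KineticTheory.T3 → Literature.MathematicalPhysics.KineticTheory.V3), Continuous a₀ → Continuous θ₀ → Continuous u₀ → (∀ x, 0 < a₀ x) → (∀ x, 0 < θ₀ x) → ∃ σ₀ : ℝ, 0 < σ₀ ∧ ∀ σ : ℝ, 0 < σ → σ < σ₀ → ∀ (T : ℝ) (ρ θ : ℝ → Literature.MathematicalPhysics.KineticTheory.T3 → ℝ) (u : ℝ → Literature.MathematicalPhysics.KineticTheory.T3 → Literature.MathematicalPhysics.KineticTheory.V3), Literature.MathematicalPhysics.KineticTheory.IsHardSphereEulerSolution σ T ρ u θ → ∀ Φ : (N : ℕ) → Literature.Analysis.FluidPDE.HardSphereFlow (Literature.Analysis.FluidPDE.Torus.geometry (Fin 3)) (Literature.MathematicalPhysics.KineticTheory.hsDiameter σ N) (N + 1), (∀ N, MeasureTheory.IsProbabilityMeasure (Literature.MathematicalPhysics.KineticTheory.localGibbsLaw σ a₀ u₀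 θ₀ N (Φ N))) ∧ (0 < T → Literature.MathematicalPhysics.KineticTheory.TendstoHydroFieldsAt (fun N => Literature.MathematicalPhysics.KineticTheory.localGibbsLaw σ a₀ u₀ θ₀ N (Φ N)) Φ ρ u θ 0 → u 0 = u₀ ∧ θ 0 = θ₀ ∧ ((∀ N, MeasureTheory.IsProbabilityMeasure (Literature.MathematicalPhysics.KineticTheory.localGibbsLaw σ a₀ (u 0) (θ 0) N (Φ N))) ∧ (∀ χ : Literature.MathematicalPhysics.KineticTheory.T3 → ℝ, Continuous χ → ∀ δ : ℝ, 0 < δ → ∃ C : ℝ, 0 < C ∧ ∀ N : ℕ, Literature.MathematicalPhysics.KineticTheory.localGibbsLaw σ a₀ (u 0) (θ 0) N (Φ N) {z | δ < |Literature.MathematicalPhysics.KineticTheory.empiricalDensityField z χ - ∫ x, χ x * ρ 0 x|} ≤ ENNReal.ofReal (C * Real.exp (-(C⁻¹ * (N + 1)))) ∧ Literature.MathematicalPhysics.KineticTheory.localGibbsLaw σ a₀ (u 0) (θ 0) N (Φ N) {z | δ < ‖Literature.MathematicalPhysics.KineticTheory.empiricalMomentumField z χ - ∫ x, (χ x * ρ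 0 x) • u 0 x‖} ≤ ENNReal.ofReal (C * Real.exp (-(C⁻¹ * (N + 1)))) ∧ Literature.MathematicalPhysics.KineticTheory.localGibbsLaw σ a₀ (u 0) (θ 0) N (Φ N) {z | δ < |Literature.MathematicalPhysics.KineticTheory.empiricalEnergyField z χ - ∫ x, χ x * Literature.MathematicalPhysics.KineticTheory.totalEnergyDensity (ρ 0 x) (u 0 x) (θ 0 x)|} ≤ ENNReal.ofReal (C * Real.exp (-(C⁻¹ * (N + 1)))))))) → (∀ (a₀ θ₀ : Literature.MathematicalPhysics.KineticTheory.T3 → ℝ) (u₀ : Literature.MathematicalPhysics.KineticTheory.T3 → Literature.MathematicalPhysics.KineticTheory.V3), Continuous a₀ → Continuous θ₀ → Continuous u₀ → (∀ x, 0 < a₀ x) → (∀ x, 0 < θ₀ x) → ∃ σ₀ : ℝ, 0 < σ₀ ∧ ∀ σ : ℝ, 0 < σ → σ < σ₀ → ∀ (T : ℝ) (ρ θ : ℝ → Literature.MathematicalPhysics.KineticTheory.T3 → ℝ) (u : ℝ → Literature.MathematicalPhysics.KineticTheory.T3 → Literature.MathematicalPhysics.KineticTheory.V3), Literature.MathematicalPhysics.KineticTheory.IsHardSphereEulerSolution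 σ T ρ u θ → ∀ Φ : (N : ℕ) → Literature.Analysis.FluidPDE.HardSphereFlow (Literature.Analysis.FluidPDE.Torus.geometry (Fin 3)) (Literature.MathematicalPhysics.KineticTheory.hsDiameter σ N) (N + 1), (Literature.MathematicalPhysics.KineticTheory.TendstoHydroFieldsAt (fun N => Literature.MathematicalPhysics.KineticTheory.localGibbsLaw σ a₀ u₀ θ₀ N (Φ N)) Φ ρ u θ 0 → ∀ s ∈ Set.Ioo 0 T, ∃ b : Literature.MathematicalPhysics.KineticTheory.T3 → ℝ, ((∀ N, MeasureTheory.IsProbabilityMeasure (Literature.MathematicalPhysics.KineticTheory.localGibbsLaw σ b (u s) (θ s) N (Φ N))) ∧ (∀ χ : Literature.MathematicalPhysics.KineticTheory.T3 → ℝ, Continuous χ → ∀ δ : ℝ, 0 < δ → ∃ C : ℝ, 0 < C ∧ ∀ N : ℕ, Literature.MathematicalPhysics.KineticTheory.localGibbsLaw σ b (u s) (θ s) N (Φ N) {z | δ < |Literature.MathematicalPhysics.KineticTheory.empiricalDensityField z χ - ∫ x, χ x * ρ s x|} ≤ ENNReal.ofReal (C * Real.exp (-(C⁻¹ * (N + 1))))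 ∧ Literature.MathematicalPhysics.KineticTheory.localGibbsLaw σ b (u s) (θ s) N (Φ N) {z | δ < ‖Literature.MathematicalPhysics.KineticTheory.empiricalMomentumField z χ - ∫ x, (χ x * ρ s x) • u s x‖} ≤ ENNReal.ofReal (C * Real.exp (-(C⁻¹ * (N + 1)))) ∧ Literature.MathematicalPhysics.KineticTheory.localGibbsLaw σ b (u s) (θ s) N (Φ N) {z | δ < |Literature.MathematicalPhysics.KineticTheory.empiricalEnergyField z χ - ∫ x, χ x * Literature.MathematicalPhysics.KineticTheory.totalEnergyDensity (ρ s x) (u s x) (θ s x)|} ≤ ENNReal.ofReal (C * Real.exp (-(C⁻¹ * (N + 1)))))))) → (Summit.AtomisticToContinuum.HydrodynamicLimit.Theses.PesinPricing.PricedBoltzmannProperty → Summit.AtomisticToContinuum.HydrodynamicLimit.Theses.PesinPricing.EnergyCurrentTails → ∀ (a₀ θ₀ : Literature.MathematicalPhysics.KineticTheory.T3 → ℝ) (u₀ : Literature.MathematicalPhysics.KineticTheory.T3 → Literature.MathematicalPhysics.KineticTheory.V3), Continuous a₀ → Continuous θ₀ → Continuous u₀ → (∀ x, 0 < a₀ x)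 → (∀ x, 0 < θ₀ x) → ∃ σ₀ : ℝ, 0 < σ₀ ∧ ∀ σ : ℝ, 0 < σ → σ < σ₀ → ∀ (T : ℝ) (ρ θ : ℝ → Literature.MathematicalPhysics.KineticTheory.T3 → ℝ) (u : ℝ → Literature.MathematicalPhysics.KineticTheory.T3 → Literature.MathematicalPhysics.KineticTheory.V3), Literature.MathematicalPhysics.KineticTheory.IsHardSphereEulerSolution σ T ρ u θ → ∀ Φ : (N : ℕ) → Literature.Analysis.FluidPDE.HardSphereFlow (Literature.Analysis.FluidPDE.Torus.geometry (Fin 3)) (Literature.MathematicalPhysics.KineticTheory.hsDiameter σ N) (N + 1), ∀ a : ℝ → Literature.MathematicalPhysics.KineticTheory.T3 → ℝ, a 0 = a₀ → u 0 = u₀ → θ 0 = θ₀ → Literature.MathematicalPhysics.KineticTheory.TendstoHydroFieldsAt (fun N => Literature.MathematicalPhysics.KineticTheory.localGibbsLaw σ a₀ u₀ θ₀ N (Φ N)) Φ ρ u θ 0 → (∀ s ∈ Set.Ico 0 T, ((∀ N, MeasureTheory.IsProbabilityMeasure (Literature.MathematicalPhysics.KineticTheory.localGibbsLaw σ (a s)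 (u s) (θ s) N (Φ N))) ∧ (∀ χ : Literature.MathematicalPhysics.KineticTheory.T3 → ℝ, Continuous χ → ∀ δ : ℝ, 0 < δ → ∃ C : ℝ, 0 < C ∧ ∀ N : ℕ, Literature.MathematicalPhysics.KineticTheory.localGibbsLaw σ (a s) (u s) (θ s) N (Φ N) {z | δ < |Literature.MathematicalPhysics.KineticTheory.empiricalDensityField z χ - ∫ x, χ x * ρ s x|} ≤ ENNReal.ofReal (C * Real.exp (-(C⁻¹ * (N + 1)))) ∧ Literature.MathematicalPhysics.KineticTheory.localGibbsLaw σ (a s) (u s) (θ s) N (Φ N) {z | δ < ‖Literature.MathematicalPhysics.KineticTheory.empiricalMomentumField z χ - ∫ x, (χ x * ρ s x) • u s x‖} ≤ ENNReal.ofReal (C * Real.exp (-(C⁻¹ * (N + 1)))) ∧ Literature.MathematicalPhysics.KineticTheory.localGibbsLaw σ (a s) (u s) (θ s) N (Φ N) {z | δ < |Literature.MathematicalPhysics.KineticTheory.empiricalEnergyField z χ - ∫ x, χ x * Literature.MathematicalPhysics.KineticTheory.totalEnergyDensity (ρ s x) (u s x) (θ s x)|} ≤ ENNReal.ofReal (C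 * Real.exp (-(C⁻¹ * (N + 1))))))) → ∀ t ∈ Set.Ico 0 T, Filter.Tendsto (fun N : ℕ => InformationTheory.klDiv ((Φ N).lawAt (Literature.MathematicalPhysics.KineticTheory.localGibbsLaw σ a₀ u₀ θ₀ N (Φ N)) t) (Literature.MathematicalPhysics.KineticTheory.localGibbsLaw σ (a t) (u t) (θ t) N (Φ N)) / ((N : ENNReal) + 1)) Filter.atTop (nhds 0)) → (Summit.AtomisticToContinuum.HydrodynamicLimit.Theses.PesinPricing.PricedBoltzmannProperty → Summit.AtomisticToContinuum.HydrodynamicLimit.Theses.PesinPricing.EnergyCurrentTails → Summit.AtomisticToContinuum.HydrodynamicLimit.Theses.PesinPricing.RelEntropyVanishing) := by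
  intro hI hF hB hPBP hECT a₀ θ₀ u₀ ha hθ hu hap hθp
  obtain ⟨σ₁, hσ₁, H1⟩ := hI a₀ θ₀ u₀ ha hθ hu hap hθp
  obtain ⟨σ₂, hσ₂, H2⟩ := hF a₀ θ₀ u₀ ha hθ hu hap hθp
  obtain ⟨σ₃, hσ₃, H3⟩ := hB hPBP hECT a₀ θ₀ u₀ ha hθ hu hap hθp
  refine ⟨min σ₁ (min σ₂ σ₃), lt_min hσ₁ (lt_min hσ₂ hσ₃), ?_⟩
  intro σ hσ hσlt T ρ θ u hsol Φ
  have hσ₁' : σ < σ₁ := lt_of_lt_of_le hσlt (min_le_left _ _)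
  have hσ₂' : σ < σ₂ := lt_of_lt_of_le hσlt ((min_le_right _ _).trans (min_le_left _ _))
  have hσ₃' : σ < σ₃ := lt_of_lt_of_le hσlt ((min_le_right _ _).trans (min_le_right _ _))
  obtain ⟨hprob, hid⟩ := H1 σ hσ hσ₁' T ρ θ u hsol Φ
  refine ⟨hprob, ?_⟩
  intro h0 t ht
  have hT : 0 < T := lt_of_le_of_lt ht.1 ht.2
  obtain ⟨hu0, hθ0, hgood0⟩ := hid hT h0
  have hpos := H2 σ hσ hσ₂' T ρ θ u hsol Φ h0
  classical
  -- glue the time-0 reference `a₀` and the positive-time references into one family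
  obtain ⟨a, ha0, hgood⟩ : ∃ a : ℝ → Literature.MathematicalPhysics.KineticTheory.T3 → ℝ, a 0 = a₀ ∧ ∀ s ∈ Set.Ico 0 T, ((∀ N, MeasureTheory.IsProbabilityMeasure (Literature.MathematicalPhysics.KineticTheory.localGibbsLaw σ (a s) (u s) (θ s) N (Φ N))) ∧ (∀ χ : Literature.MathematicalPhysics.KineticTheory.T3 → ℝ, Continuous χ → ∀ δ : ℝ, 0 < δ → ∃ C : ℝ, 0 < C ∧ ∀ N : ℕ, Literature.MathematicalPhysics.KineticTheory.localGibbsLaw σ (a s) (u s) (θ s) N (Φ N) {z | δ < |Literature.MathematicalPhysics.KineticTheory.empiricalDensityField z χ - ∫ x, χ x * ρ s x|} ≤ ENNReal.ofReal (C * Real.exp (-(C⁻¹ * (N + 1)))) ∧ Literature.MathematicalPhysics.KineticTheory.localGibbsLaw σ (a s) (u s) (θ s) N (Φ N) {z | δ < ‖Literature.MathematicalPhysics.KineticTheory.empiricalMomentumField z χ - ∫ x, (χ x * ρ s x) • u s x‖} ≤ ENNReal.ofReal (C * Real.exp (-(C⁻¹ * (N + 1)))) ∧ Literature.MathematicalPhysics.KineticTheory.localGibbsLaw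 σ (a s) (u s) (θ s) N (Φ N) {z | δ < |Literature.MathematicalPhysics.KineticTheory.empiricalEnergyField z χ - ∫ x, χ x * Literature.MathematicalPhysics.KineticTheory.totalEnergyDensity (ρ s x) (u s x) (θ s x)|} ≤ ENNReal.ofReal (C * Real.exp (-(C⁻¹ * (N + 1)))))) := by
    refine ⟨fun s => if hs : s ∈ Set.Ioo 0 T then Classical.choose (hpos s hs) else a₀, ?_, ?_⟩
    · have h00 : ¬ ((0 : ℝ) ∈ Set.Ioo 0 T) := fun h => lt_irrefl _ h.1
      simp only [h00, dif_neg, not_false_eq_true]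
    · intro s hs
      by_cases hs' : s ∈ Set.Ioo 0 T
      · have hcs := Classical.choose_spec (hpos s hs')
        simp only [hs', dif_pos]
        exact hcs
      · have hs0 : s = 0 := by
          by_contra hne
          exact hs' ⟨lt_of_le_of_ne hs.1 (Ne.symm hne), hs.2⟩
        subst hs0
        simp only [hs', dif_neg, not_false_eq_true]
        exact hgood0
  exact ⟨a t, (hgood t ht).1, (hgood t ht).2, H3 σ hσ hσ₃' T ρ θ u hsol Φ a ha0 hu0 hθ0 h0 hgood t ht⟩

/-- THE REGISTERED SKELETON THEOREM — concludes the crux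
`Summit.AtomisticToContinuum.HydrodynamicLimit.Theses.PesinPricing.GronwallU` BY NAME with no
hypotheses: the pure-logic assembly `GronwallU_of_stubs` applied to the three declared stubs (the only
places `sorry` occurs). Closing the three stubs closes the crux. -/
theorem GronwallU_of : Summit.AtomisticToContinuum.HydrodynamicLimit.Theses.PesinPricing.GronwallU :=
  GronwallU_of_stubs stub_initialReference stub_referenceFamily stub_entropyGronwall

end Summit.AtomisticToContinuum.HydrodynamicLimit.Cruxes.GronwallU.Birth
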